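import Summits.AtomisticToContinuum.Crystallization.Theorems.FrustratedLawDichotomyStrainedPatchTaylorPair
import Summits.AtomisticToContinuum.Crystallization.Theorems.FrustratedLawDichotomyStrainedPatchTaylorChord

/-!
# (P2a-core) `PairChord ⟸ WrecC1 ∧ KbandCert`: the pair chord lemma from regularity and band numerics of `W₄₅` (lens-5 g53, crux 27623 T-side)

Instantiates the generic C^{1,1} chord lemma `…TaylorChord.chordC11_holds` for the record potential `Wrec = W₄₅ = effPot w₄₅ ω₄ (3/400)` on the chord
between two partners at distances `‖p‖, ‖p + Δ‖ ≥ 7/10` with `‖Δ‖ ≤ 1/10`: the chord GEOMETRY is proved here (`norm_sq_line`, `chord_floor`: the segment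
stays at norm `≥ 0.69821`, `chord_tube`), leaving exactly TWO leaves about the one-variable function `W₄₅`:
(R) `WrecC1` — `W₄₅′` continuous on `(0, ∞)` and differentiable off the junction radii `{8/5, 3, 9/2}` [routine piecewise calculus from
`hasDerivAt_effPot45` and `deriv_effPot45_{bump,lj,window,far}`]; (N) `KbandCert` — on each band `[chordLo r, r + 1/10]` the bounds `|W₄₅″| ≤ Kband r`,
`|W₄₅′(s)| ≤ Kband r · s` [interval numerics, 11 bands].  Seams: `pairChord_of_pieces : ChordC11 → WrecC1 → KbandCert → PairChord`,
`pairChord_of_leaves : WrecC1 → KbandCert → PairChord`, and with `…TaylorPair.taylorTwoBent1_of_pairChord` the leaf-level seam of node (T2-bent₁):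
`taylorTwoBent1_of_leaves : WrecC1 → KbandCert → BeyondBallTail → TaylorTwoBent1`.
-/

open scoped BigOperators Classical
open Summit.AtomisticToContinuum.Crystallization.Theorems.FrustratedLawDichotomyRangeCut (Sep)
open Summit.AtomisticToContinuum.Crystallization.Theorems.FrustratedLawDichotomyMotifLemmas
open Summit.AtomisticToContinuum.Crystallization.Theorems.FrustratedLawDichotomyAveragingCut
open Summit.AtomisticToContinuum.Crystallization.Theorems.FrustratedLawDichotomyAveragingRuleCap
open Summit.AtomisticToContinuum.Crystallization.Theorems.FrustratedLawDichotomyAveragingRuleTightFree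
open Summit.AtomisticToContinuum.Crystallization.Theorems.FrustratedLawDichotomyExemptAbsorptionRecord
open Summit.AtomisticToContinuum.Crystallization.Theorems.FrustratedLawDichotomySchurCut
open Literature.MathematicalPhysics.StatisticalMechanics (lennardJones lennardJones_nonpos)
open Summit.AtomisticToContinuum.Crystallization.Theorems.FrustratedLawDichotomyRuleToolkitGood
open Summit.AtomisticToContinuum.Crystallization.Theorems.FrustratedLawDichotomyStrainedPatchHomSplit
open Summit.AtomisticToContinuum.Crystallization.Theorems.FrustratedLawDichotomyStrainedPatchHomTermCalculus
open Summit.AtomisticToContinuum.Crystallization.Theorems.FrustratedLawDichotomyStrainedPatchChartFamilies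
open Summit.AtomisticToContinuum.Crystallization.Theorems.FrustratedLawDichotomyStrainedPatchChartFamiliesBent
open Summit.AtomisticToContinuum.Crystallization.Theorems.FrustratedLawDichotomyStrainedPatchChartFamiliesPinned
open Summit.AtomisticToContinuum.Crystallization.Theorems.FrustratedLawDichotomyStrainedPatchEnvelopeLaw
open Summit.AtomisticToContinuum.Crystallization.Theorems.FrustratedLawDichotomyStrainedPatchEnvelopeTaylor

open Summit.AtomisticToContinuum.Crystallization.Theorems.FrustratedLawDichotomyStrainedPatchTaylorSplit
open Summit.AtomisticToContinuum.Crystallization.Theorems.FrustratedLawDichotomyStrainedPatchTaylorPair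
open Summit.AtomisticToContinuum.Crystallization.Theorems.FrustratedLawDichotomyStrainedPatchTaylorChord

namespace Summit.AtomisticToContinuum.Crystallization.Theorems.FrustratedLawDichotomyStrainedPatchTaylorLeaves

/-! ## §1. Junction radii, chord floor, the two leaves -/

/-- Junction radii of `W₄₅` (bump off at `8/5`, window on at `3`, range `9/2`); off these `W₄₅` is real-analytic on `(0, ∞)`. -/
noncomputable def junctions : Finset ℝ := {8 / 5, 3, 9 / 2}

/-- The chord floor for a pair at distance `r`: the segment between two points of norm `≥ 7/10` at distance `≤ 1/10` stays at norm
`≥ max(r − 1/10, 0.69821)` (`0.69821² < 49/100 − 1/400`). -/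
noncomputable def chordLo (r : ℝ) : ℝ := max (r - 1 / 10) (69821 / 100000)

/-- **(R) `WrecC1`** [CALCULUS · regularity of the record potential · TRUE-type, routine from `hasDerivAt_effPot45` and the four regime formulas] —
`W₄₅′` is continuous on `(0, ∞)` and differentiable off the junction radii. -/
def WrecC1 : Prop := ContinuousOn (deriv Wrec) (Set.Ioi 0) ∧ ∀ r : ℝ, 0 < r → r ∉ junctions → DifferentiableAt ℝ (deriv Wrec) r

/-- **(N) `KbandCert`** [CERTIFIED NUMERICS · 11 bands · TRUE-type with slack ≥ 1.2 (instrument KBANDCERT53)] — on the `s`-range of each band,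
`|W₄₅″(s)| ≤ Kband r` and `|W₄₅′(s)| ≤ Kband r · s` (off the junction radii, where `W″ = deriv (deriv W)` is classical). -/
def KbandCert : Prop :=
  ∀ r s : ℝ, 7 / 10 ≤ r → chordLo r ≤ s → s ≤ r + 1 / 10 → s ∉ junctions → |deriv (deriv Wrec) s| ≤ Kband r ∧ |deriv Wrec s| ≤ Kband r * s

/-- `Kband ≥ 0`. [formal bookkeeping] -/
theorem Kband_nonneg (r : ℝ) : 0 ≤ Kband r := by
  unfold Kband
  split_ifs <;> norm_num

/-- `W₄₅` is differentiable off `0`. [formal bookkeeping] -/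
theorem differentiableAt_Wrec {r : ℝ} (hr : r ≠ 0) : DifferentiableAt ℝ Wrec r := differentiableAt_effPot45 hr

/-- The norm along a segment: `‖u + sΔ‖² = (1 − s)‖u‖² + s‖u + Δ‖² − s(1 − s)‖Δ‖²`. [folklore] -/
theorem norm_sq_line (u Δ : E3) (s : ℝ) : ‖u + s • Δ‖ ^ 2 = (1 - s) * ‖u‖ ^ 2 + s * ‖u + Δ‖ ^ 2 - s * (1 - s) * ‖Δ‖ ^ 2 := by
  have h1 := norm_add_sq_real u (s • Δ)
  have h2 := norm_add_sq_real u Δ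
  rw [real_inner_smul_right, norm_smul, mul_pow, Real.norm_eq_abs, sq_abs] at h1
  linear_combination h1 - s * h2

/-- ★ THE CHORD FLOOR: two points of norm `≥ 7/10` at distance `≤ 1/10` span a segment at norm `≥ 0.69821`. [folklore] -/
theorem chord_floor {p Δ : E3} (h1 : 7 / 10 ≤ ‖p‖) (h2 : 7 / 10 ≤ ‖p + Δ‖) (h3 : ‖Δ‖ ≤ 1 / 10) {s : ℝ} (hs0 : 0 ≤ s) (hs1 : s ≤ 1) :
    69821 / 100000 ≤ ‖p + s • Δ‖ := by
  have hid := norm_sq_line p Δ s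
  have hp2 : 49 / 100 ≤ ‖p‖ ^ 2 := by nlinarith
  have hq2 : 49 / 100 ≤ ‖p + Δ‖ ^ 2 := by nlinarith
  have hd2 : ‖Δ‖ ^ 2 ≤ 1 / 100 := by nlinarith [norm_nonneg Δ]
  have hss : s * (1 - s) ≤ 1 / 4 := by nlinarith [sq_nonneg (2 * s - 1)]
  have ha := mul_le_mul_of_nonneg_left hp2 (by linarith : (0 : ℝ) ≤ 1 - s)
  have hb := mul_le_mul_of_nonneg_left hq2 hs0
  have hc : s * (1 - s) * ‖Δ‖ ^ 2 ≤ 1 / 4 * (1 / 100) := mul_le_mul hss hd2 (sq_nonneg _) (by norm_num)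
  have hx2 : 4875 / 10000 ≤ ‖p + s • Δ‖ ^ 2 := by rw [hid]; linarith
  nlinarith [norm_nonneg (p + s • Δ)]

/-- The tube: `chordLo ‖p‖ ≤ ‖p + sΔ‖ ≤ ‖p‖ + 1/10` for `0 ≤ s ≤ 1`. [folklore] -/
theorem chord_tube {p Δ : E3} (h1 : 7 / 10 ≤ ‖p‖) (h2 : 7 / 10 ≤ ‖p + Δ‖) (h3 : ‖Δ‖ ≤ 1 / 10) {s : ℝ} (hs : s ∈ Set.Icc (0 : ℝ) 1) :
    chordLo ‖p‖ ≤ ‖p + s • Δ‖ ∧ ‖p + s • Δ‖ ≤ ‖p‖ + 1 / 10 := by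
  have hsn : ‖s • Δ‖ = s * ‖Δ‖ := by rw [norm_smul, Real.norm_eq_abs, abs_of_nonneg hs.1]
  have hsd : s * ‖Δ‖ ≤ 1 / 10 := by nlinarith [norm_nonneg Δ, hs.1, hs.2]
  have hup : ‖p + s • Δ‖ ≤ ‖p‖ + 1 / 10 := by
    have := norm_add_le p (s • Δ); rw [hsn] at this; linarith
  have hlow : ‖p‖ - 1 / 10 ≤ ‖p + s • Δ‖ := by
    have := norm_sub_le (p + s • Δ) (s • Δ); rw [add_sub_cancel_right, hsn] at this; linarith
  exact ⟨max_le hlow (chord_floor h1 h2 h3 hs.1 hs.2), hup⟩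

/-- `0 < chordLo r`. [formal bookkeeping] -/
theorem chordLo_pos (r : ℝ) : 0 < chordLo r := lt_of_lt_of_le (by norm_num) (le_max_right _ _)

/-! ## §2. Seams -/

/-- ★★ **(P2a-core) ⟸ (C) ∧ (R) ∧ (N)**: the pair chord lemma from the generic chord lemma, the regularity of `W₄₅` and the band numerics —
instantiate `W = W₄₅`, `W₁ = W₄₅′`, `J = junctions`, `K = Kband‖p‖`, `[a, b] = [chordLo‖p‖, ‖p‖ + 1/10]`. [folklore] -/
theorem pairChord_of_pieces (hC : ChordC11) (hR : WrecC1) (hK : KbandCert) : PairChord := by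
  intro p Δ h1 h2 h3
  have ha := chordLo_pos ‖p‖
  have hW : ∀ r, chordLo ‖p‖ ≤ r → r ≤ ‖p‖ + 1 / 10 → HasDerivAt Wrec (deriv Wrec r) r := fun r hr _ =>
    (differentiableAt_Wrec (ha.trans_le hr).ne').hasDerivAt
  have hcont : ContinuousOn (deriv Wrec) (Set.Icc (chordLo ‖p‖) (‖p‖ + 1 / 10)) := hR.1.mono fun r hr => ha.trans_le hr.1
  have hgood : ∀ r, chordLo ‖p‖ < r → r < ‖p‖ + 1 / 10 → r ∉ junctions →
      HasDerivAt (deriv Wrec) (deriv (deriv Wrec) r) r ∧ |deriv (deriv Wrec) r| ≤ Kband ‖p‖ ∧ |deriv Wrec r| ≤ Kband ‖p‖ * r :=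
    fun r hr1 hr2 hJ => ⟨(hR.2 r (ha.trans hr1) hJ).hasDerivAt, hK ‖p‖ r h1 hr1.le hr2.le hJ⟩
  exact hC Wrec (deriv Wrec) junctions (Kband ‖p‖) (chordLo ‖p‖) (‖p‖ + 1 / 10) p Δ ha (Kband_nonneg _) hW hcont hgood
    (fun s hs => chord_tube h1 h2 h3 hs)

/-- ★★ (P2a-core) from the TWO remaining leaves (R) ∧ (N) ((C) is `chordC11_holds`). [folklore] -/
theorem pairChord_of_leaves (hR : WrecC1) (hK : KbandCert) : PairChord := pairChord_of_pieces chordC11_holds hR hK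

/-- ★★ THE (T2-bent₁) SEAM AT LEAF LEVEL: (R) ∧ (N) ∧ (P3b) ⟹ `TaylorTwoBent1`. [folklore] -/
theorem taylorTwoBent1_of_leaves (hR : WrecC1) (hK : KbandCert) (h3b : BeyondBallTail) : TaylorTwoBent1 :=
  taylorTwoBent1_of_pairChord (pairChord_of_leaves hR hK) h3b

end Summit.AtomisticToContinuum.Crystallization.Theorems.FrustratedLawDichotomyStrainedPatchTaylorLeaves
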